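import Summits.KontsevichZagierPeriods.KontsevichZagierPeriods.Theorems.GpcLegendreLemniscatic.Negative.Canonical

/-!
# `LegendreAllModuli` (stmt-KontsevichZagierPeriods-3523), line `Sketch`, stub M2 `stub_octantTransfer` — part 1:
Jacobi's sphero-conal map (pure real algebra)

For a parameter `m ∈ (0,1)` the map `Φ_m(x,y) = (X,Z) = (x·√(1 − (1−m)y²), y·√(1 − m x²))` sends the
open unit square `(0,1)²` bijectively onto the open quarter disc `Q = {X > 0, Z > 0, X² + Z² < 1}`
(planar chart of the open positive octant of `S²`; the third coordinate is `Y = √((1−x²)(1−y²))`,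
`X² + Y² + Z² = 1`). Its Jacobian determinant is
`det DΦ_m = (1 − m x² − (1−m) y²)/(√(1 − m x²)·√(1 − (1−m) y²)) > 0`, and THE ALGEBRAIC HEART of the
line is the pointwise identity
`F_m(x,y) = (1 − X² − Z²)^{-1/2} · det DΦ_m(x,y)`,
where `F_m = κ_m ⊗ e_{1−m} + e_m ⊗ κ_{1−m} − κ_m ⊗ κ_{1−m}` is the one-representation Legendre integrand
(`κ_m(t) = ((1−t²)(1−mt²))^{-1/2}`, `e_m(t) = (1−mt²)^{1/2}(1−t²)^{-1/2}`): the Legendre 2-form is the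
area form of the octant in sphero-conal coordinates, so Legendre's relation `E K′ + E′ K − K K′ = π/2`
at every modulus reads "the octant has area `π/2`".

This file: `Φ_m : (0,1)² → Q` is a bijection (`mapsTo`, `injOn` by the sign argument on the quadratic
`(1−m)b² − (1 − mX² + (1−m)Z²)b + Z²`, `surjOn` by its smaller root) and the Jacobian identity.
Part 2 (`…StubOctantTransfer.lean`) makes ONE rule-(2) move of it. No definitions are introduced:
the map `Φ` enters every statement as an argument with its two defining equations `hΦ0`, `hΦ1`
(instantiated in part 2 by the explicit term).

Source of the coordinates: C. G. J. Jacobi, *Vorlesungen über Dynamik*, 26th lecture (sphero-conal /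
elliptic coordinates on the sphere); NIST DLMF §29.18. The proofs below are elementary real algebra.
-/

-- adapted from Cruxes/GpcLegendreLemniscatic/SketchIdeator2g2.lean (crux-ideate seat, stmt-0280, ideator 2 gen 2)

noncomputable section

open Set
open Summit.KontsevichZagierPeriods.Grothendieck.GpcLegendreLemniscaticNegative (unitSq)

namespace Summit.KontsevichZagierPeriods.UnfoldedStokes.LegendreAllModuliLine

namespace M2

section positivity_facts
variable {m : ℝ} {x : Fin 2 → ℝ}

/-- On the square, `x₀² < 1`. [folklore] -/
theorem sq_lt_one_zero (hx : x ∈ unitSq) : x 0 ^ 2 < 1 := by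
  have h0 := hx 0; nlinarith [h0.1, h0.2]

/-- On the square, `x₁² < 1`. [folklore] -/
theorem sq_lt_one_one (hx : x ∈ unitSq) : x 1 ^ 2 < 1 := by
  have h1 := hx 1; nlinarith [h1.1, h1.2]

/-- On the square, `0 < 1 − m x₀²` for `m ∈ (0,1)`. [folklore] -/
theorem radC_pos (hm : m ∈ Ioo (0:ℝ) 1) (hx : x ∈ unitSq) : 0 < 1 - m * x 0 ^ 2 := by
  nlinarith [mul_lt_mul_of_pos_left (sq_lt_one_zero hx) hm.1, hm.2]

/-- On the square, `0 < 1 − (1−m) x₁²` for `m ∈ (0,1)`. [folklore] -/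
theorem radD_pos (hm : m ∈ Ioo (0:ℝ) 1) (hx : x ∈ unitSq) : 0 < 1 - (1 - m) * x 1 ^ 2 := by
  nlinarith [mul_lt_mul_of_pos_left (sq_lt_one_one hx) (sub_pos.2 hm.2), hm.1]

/-- On the square, the numerator of the Jacobian is positive: `0 < 1 − m x₀² − (1−m) x₁²`. [folklore] -/
theorem detNum_pos (hm : m ∈ Ioo (0:ℝ) 1) (hx : x ∈ unitSq) : 0 < 1 - m * x 0 ^ 2 - (1 - m) * x 1 ^ 2 := by
  nlinarith [mul_lt_mul_of_pos_left (sq_lt_one_zero hx) hm.1,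
    mul_lt_mul_of_pos_left (sq_lt_one_one hx) (sub_pos.2 hm.2)]

end positivity_facts

section sphero_conal

variable {m : ℝ} {Φ : (Fin 2 → ℝ) → (Fin 2 → ℝ)}

/-- **`Φ_m` maps the open square into the open quarter disc** (`1 − X² − Z² = (1−x²)(1−y²) > 0`). [folklore] -/
theorem spheroConal_mapsTo (hm : m ∈ Ioo (0:ℝ) 1)
    (hΦ0 : ∀ x, Φ x 0 = x 0 * Real.sqrt (1 - (1 - m) * x 1 ^ 2))
    (hΦ1 : ∀ x, Φ x 1 = x 1 * Real.sqrt (1 - m * x 0 ^ 2)) :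
    MapsTo Φ unitSq {w : Fin 2 → ℝ | 0 < w 0 ∧ 0 < w 1 ∧ w 0 ^ 2 + w 1 ^ 2 < 1} := by
  intro x hx
  have h0 := hx 0
  have h1 := hx 1
  have hA : 0 < 1 - x 0 ^ 2 := by linarith [sq_lt_one_zero hx]
  have hB : 0 < 1 - x 1 ^ 2 := by linarith [sq_lt_one_one hx]
  have hC := radC_pos hm hx
  have hD := radD_pos hm hx
  refine ⟨?_, ?_, ?_⟩
  · rw [hΦ0]; exact mul_pos h0.1 (Real.sqrt_pos.2 hD)
  · rw [hΦ1]; exact mul_pos h1.1 (Real.sqrt_pos.2 hC)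
  · rw [hΦ0, hΦ1, mul_pow, mul_pow, Real.sq_sqrt hD.le, Real.sq_sqrt hC.le]
    nlinarith [mul_pos hA hB]

/-- **`Φ_m` is injective on the open square** — the sign argument: with `a = x²`, `b = y²`, both `b` and
`b′` are roots of the same quadratic `q(t) = (1−m)t² − (1 − mX² + (1−m)Z²)t + Z²`, both are `< 1`, and
`q(1) = −m(1 − X² − Z²) < 0` forbids two roots below `1`; then `a = a′` from `X² = a(1 − (1−m)b)`.
[folklore] -/
theorem spheroConal_injOn (hm : m ∈ Ioo (0:ℝ) 1)
    (hΦ0 : ∀ x, Φ x 0 = x 0 * Real.sqrt (1 - (1 - m) * x 1 ^ 2))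
    (hΦ1 : ∀ x, Φ x 1 = x 1 * Real.sqrt (1 - m * x 0 ^ 2)) : InjOn Φ unitSq := by
  intro x hx x' hx' heq
  have h0 := hx 0
  have h1 := hx 1
  have h0' := hx' 0
  have h1' := hx' 1
  have ha1 : x 0 ^ 2 < 1 := sq_lt_one_zero hx
  have hb1 : x 1 ^ 2 < 1 := sq_lt_one_one hx
  have hb1' : x' 1 ^ 2 < 1 := sq_lt_one_one hx'
  have hC : 0 < 1 - m * x 0 ^ 2 := radC_pos hm hx
  have hD : 0 < 1 - (1 - m) * x 1 ^ 2 := radD_pos hm hx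
  have hC' : 0 < 1 - m * x' 0 ^ 2 := radC_pos hm hx'
  have hD' : 0 < 1 - (1 - m) * x' 1 ^ 2 := radD_pos hm hx'
  have hX : x 0 * Real.sqrt (1 - (1 - m) * x 1 ^ 2) = x' 0 * Real.sqrt (1 - (1 - m) * x' 1 ^ 2) := by
    have := congrFun heq 0
    rwa [hΦ0, hΦ0] at this
  have hZ : x 1 * Real.sqrt (1 - m * x 0 ^ 2) = x' 1 * Real.sqrt (1 - m * x' 0 ^ 2) := by
    have := congrFun heq 1
    rwa [hΦ1, hΦ1] at this
  have hX2 : x 0 ^ 2 * (1 - (1 - m) * x 1 ^ 2) = x' 0 ^ 2 * (1 - (1 - m) * x' 1 ^ 2) := by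
    have := congrArg (fun t => t ^ 2) hX
    simpa only [mul_pow, Real.sq_sqrt hD.le, Real.sq_sqrt hD'.le] using this
  have hZ2 : x 1 ^ 2 * (1 - m * x 0 ^ 2) = x' 1 ^ 2 * (1 - m * x' 0 ^ 2) := by
    have := congrArg (fun t => t ^ 2) hZ
    simpa only [mul_pow, Real.sq_sqrt hC.le, Real.sq_sqrt hC'.le] using this
  -- pass to the squares
  set a := x 0 ^ 2 with ha
  set b := x 1 ^ 2 with hb
  set a' := x' 0 ^ 2 with ha'
  set b' := x' 1 ^ 2 with hb'
  -- the quadratic: q(b) = 0 (identity) and q(b') = 0 (through hX2, hZ2)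
  have hqb : (1 - m) * b ^ 2 - (1 - m * (a * (1 - (1 - m) * b)) + (1 - m) * (b * (1 - m * a))) * b +
      b * (1 - m * a) = 0 := by ring
  have hqb' : (1 - m) * b' ^ 2 - (1 - m * (a * (1 - (1 - m) * b)) + (1 - m) * (b * (1 - m * a))) * b' +
      b * (1 - m * a) = 0 := by
    rw [hX2, hZ2]; ring
  have hbb : b = b' := by
    by_contra hne
    have hdiff : (b - b') * ((1 - m) * (b + b') -
        (1 - m * (a * (1 - (1 - m) * b)) + (1 - m) * (b * (1 - m * a)))) = 0 := by
      linear_combination hqb - hqb'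
    rcases mul_eq_zero.1 hdiff with h | h
    · exact hne (sub_eq_zero.1 h)
    · have e2 : b * (1 - m * a) - (1 - m) * b * b' = 0 := by linear_combination hqb - b * h
      have key : (1 - m) * (1 - b) * (1 - b') + m * ((1 - a) * (1 - b)) = 0 := by
        linear_combination (-1 : ℝ) * h - e2
      have p1 : 0 < (1 - m) * (1 - b) * (1 - b') :=
        mul_pos (mul_pos (sub_pos.2 hm.2) (sub_pos.2 hb1)) (sub_pos.2 hb1')
      have p2 : 0 < m * ((1 - a) * (1 - b)) := mul_pos hm.1 (mul_pos (sub_pos.2 ha1) (sub_pos.2 hb1))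
      linarith
  have haa : a = a' := by
    rw [← hbb] at hX2
    exact mul_right_cancel₀ hD.ne' hX2
  -- conclude
  refine funext_iff.2 (Fin.forall_fin_two.2 ⟨?_, ?_⟩)
  · exact (pow_left_inj₀ h0.1.le h0'.1.le two_ne_zero).1 haa
  · exact (pow_left_inj₀ h1.1.le h1'.1.le two_ne_zero).1 hbb

/-- **`Φ_m` maps the open square ONTO the open quarter disc** — the explicit algebraic inverse:
`b = y²` is the smaller root `(B − √D)/(2(1−m))` of `q`, `a = x² = X²/(1 − (1−m)b)`; `0 < b < 1` and
`0 < a < 1` follow from `q(1) < 0`, `q(b*) < 0` through `4(1−m)q(t) = (2(1−m)t − B)² − D`. [folklore] -/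
theorem spheroConal_surjOn (hm : m ∈ Ioo (0:ℝ) 1)
    (hΦ0 : ∀ x, Φ x 0 = x 0 * Real.sqrt (1 - (1 - m) * x 1 ^ 2))
    (hΦ1 : ∀ x, Φ x 1 = x 1 * Real.sqrt (1 - m * x 0 ^ 2)) :
    SurjOn Φ unitSq {w : Fin 2 → ℝ | 0 < w 0 ∧ 0 < w 1 ∧ w 0 ^ 2 + w 1 ^ 2 < 1} := by
  intro w hw
  obtain ⟨hX, hZ, hXZ⟩ := hw
  set X := w 0 with hXdef
  set Z := w 1 with hZdef
  have hm0 := hm.1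
  have hm1 := hm.2
  have h1m : 0 < 1 - m := sub_pos.2 hm1
  have hgap : 0 < 1 - X ^ 2 - Z ^ 2 := by linarith
  have hX21 : X ^ 2 < 1 := by nlinarith [sq_nonneg Z]
  set B := 1 - m * X ^ 2 + (1 - m) * Z ^ 2 with hB
  set D := B ^ 2 - 4 * (1 - m) * Z ^ 2 with hDdef
  -- the completed square: 4(1-m) q(t) = (2(1-m)t - B)² - D
  have hcsq : ∀ t : ℝ, 4 * (1 - m) * ((1 - m) * t ^ 2 - B * t + Z ^ 2) = (2 * (1 - m) * t - B) ^ 2 - D := by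
    intro t; rw [hDdef]; ring
  have hq1 : (1 - m) * 1 ^ 2 - B * 1 + Z ^ 2 = -(m * (1 - X ^ 2 - Z ^ 2)) := by rw [hB]; ring
  have hDpos : 0 < D := by
    have h := hcsq 1
    rw [hq1] at h
    nlinarith [sq_nonneg (2 * (1 - m) * 1 - B), mul_pos h1m (mul_pos hm0 hgap)]
  set s := Real.sqrt D with hsdef
  have hs0 : 0 < s := Real.sqrt_pos.2 hDpos
  have hs2 : s ^ 2 = D := Real.sq_sqrt hDpos.le
  set b := (B - s) / (2 * (1 - m)) with hbdef
  have h2b : 2 * (1 - m) * b = B - s := by rw [hbdef]; field_simp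
  -- q(b) = 0
  have hqb : (1 - m) * b ^ 2 - B * b + Z ^ 2 = 0 := by
    have h := hcsq b
    have h' : (2 * (1 - m) * b - B) ^ 2 - D = 0 := by rw [h2b, ← hs2]; ring
    rw [h'] at h
    have h4 : (4 * (1 - m)) ≠ 0 := by positivity
    exact (mul_eq_zero.1 h).resolve_left h4
  -- 0 < b : s < B
  have hBpos : 0 < B := by
    rw [hB]; nlinarith [mul_lt_mul_of_pos_left hX21 hm0, mul_nonneg h1m.le (sq_nonneg Z)]
  have hsB : s < B := by
    rw [hsdef, Real.sqrt_lt' hBpos, hDdef]; nlinarith [mul_pos h1m (pow_pos hZ 2)]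
  have hb0 : 0 < b := by rw [hbdef]; exact div_pos (by linarith) (by positivity)
  -- b < 1 : |2(1-m) - B| < s
  have hb1 : b < 1 := by
    have hsq : (2 * (1 - m) * 1 - B) ^ 2 < s ^ 2 := by
      have h := hcsq 1
      rw [hq1] at h
      rw [hs2]; nlinarith [mul_pos h1m (mul_pos hm0 hgap)]
    have hlow := (abs_lt_of_sq_lt_sq' hsq hs0.le).1
    have hlt : 2 * (1 - m) * b < 2 * (1 - m) * 1 := by linarith
    exact lt_of_mul_lt_mul_left hlt (by positivity)
  -- a
  have hc : 0 < 1 - (1 - m) * b := by nlinarith [mul_lt_mul_of_pos_left hb1 h1m]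
  set a := X ^ 2 / (1 - (1 - m) * b) with hadef
  have haX : a * (1 - (1 - m) * b) = X ^ 2 := by rw [hadef]; field_simp
  have ha0 : 0 < a := div_pos (pow_pos hX 2) hc
  have ha1 : a < 1 := by
    set bs := (1 - X ^ 2) / (1 - m) with hbs
    have hbs' : (1 - m) * bs = 1 - X ^ 2 := by rw [hbs]; field_simp
    have hqbs : (1 - m) * bs ^ 2 - B * bs + Z ^ 2 = -(X ^ 2 * (1 - X ^ 2 - Z ^ 2)) := by
      have e : (1 - m) * bs ^ 2 - B * bs + Z ^ 2 = bs * ((1 - m) * bs) - B * bs + Z ^ 2 := by ring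
      rw [e, hbs', hB]
      have e2 : bs * (1 - X ^ 2) - (1 - m * X ^ 2 + (1 - m) * Z ^ 2) * bs + Z ^ 2 =
          -((1 - m) * bs) * (X ^ 2 + Z ^ 2) + Z ^ 2 := by ring
      rw [e2, hbs']; ring
    have hsq : (2 * (1 - m) * bs - B) ^ 2 < s ^ 2 := by
      have h := hcsq bs
      rw [hqbs] at h
      rw [hs2]; nlinarith [mul_pos h1m (mul_pos (pow_pos hX 2) hgap)]
    have hlow := (abs_lt_of_sq_lt_sq' hsq hs0.le).1
    have hlt : 2 * (1 - m) * b < 2 * (1 - m) * bs := by linarith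
    have hbbs : b < bs := lt_of_mul_lt_mul_left hlt (by positivity)
    rw [hadef, div_lt_one hc]
    linarith [mul_lt_mul_of_pos_left hbbs h1m, hbs']
  -- Z-equation for the preimage
  have hbZ : b * (1 - m * a) = Z ^ 2 := by
    apply mul_left_cancel₀ hc.ne'
    have e : (1 - (1 - m) * b) * (b * (1 - m * a)) = b * (1 - (1 - m) * b) - m * b * (a * (1 - (1 - m) * b)) := by
      ring
    rw [e, haX]
    have hqb' := hqb
    rw [hB] at hqb'
    linear_combination (-1 : ℝ) * hqb'
  -- the preimage
  refine ⟨![Real.sqrt a, Real.sqrt b], ?_, ?_⟩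
  · intro i
    fin_cases i
    · show Real.sqrt a ∈ Ioo (0:ℝ) 1
      exact ⟨Real.sqrt_pos.2 ha0, (Real.sqrt_lt' one_pos).2 (by simpa using ha1)⟩
    · show Real.sqrt b ∈ Ioo (0:ℝ) 1
      exact ⟨Real.sqrt_pos.2 hb0, (Real.sqrt_lt' one_pos).2 (by simpa using hb1)⟩
  · refine funext_iff.2 (Fin.forall_fin_two.2 ⟨?_, ?_⟩)
    · rw [hΦ0]
      simp only [Matrix.cons_val_zero, Matrix.cons_val_one]
      rw [Real.sq_sqrt hb0.le, ← Real.sqrt_mul ha0.le, haX, Real.sqrt_sq hX.le]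
    · rw [hΦ1]
      simp only [Matrix.cons_val_zero, Matrix.cons_val_one]
      rw [Real.sq_sqrt ha0.le, ← Real.sqrt_mul hb0.le, hbZ, Real.sqrt_sq hZ.le]

/-- **`Φ_m '' (0,1)² = Q`** (MapsTo + SurjOn). [folklore] -/
theorem image_spheroConal (hm : m ∈ Ioo (0:ℝ) 1)
    (hΦ0 : ∀ x, Φ x 0 = x 0 * Real.sqrt (1 - (1 - m) * x 1 ^ 2))
    (hΦ1 : ∀ x, Φ x 1 = x 1 * Real.sqrt (1 - m * x 0 ^ 2)) :
    Φ '' unitSq = {w : Fin 2 → ℝ | 0 < w 0 ∧ 0 < w 1 ∧ w 0 ^ 2 + w 1 ^ 2 < 1} :=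
  (spheroConal_surjOn hm hΦ0 hΦ1).image_eq_of_mapsTo (spheroConal_mapsTo hm hΦ0 hΦ1)

/-- **The algebraic heart**: on the open square the Legendre integrand IS the pulled-back area density,
`F_m(x) = (1 − |Φ_m x|²)^{-1/2} · |det DΦ_m(x)|`, because `1 − X² − Z² = (1 − x²)(1 − y²)` and
`κe′ + eκ′ − κκ′ = (1 − m x² − (1−m)y²)/(√(1−x²)√(1−y²)·√(1−mx²)√(1−(1−m)y²))` (pure algebra of the four
square roots `a = √(1−x²)`, `b = √(1−y²)`, `c = √(1−mx²)`, `d = √(1−(1−m)y²)`: both sides equal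
`(c² + d² − 1)/(abcd)`). The left side is written VERBATIM as the `F m x` of the stub signature.
[folklore] -/
theorem jacobianIdentity (hm : m ∈ Ioo (0:ℝ) 1)
    (hΦ0 : ∀ x, Φ x 0 = x 0 * Real.sqrt (1 - (1 - m) * x 1 ^ 2))
    (hΦ1 : ∀ x, Φ x 1 = x 1 * Real.sqrt (1 - m * x 0 ^ 2)) (x : Fin 2 → ℝ) (hx : x ∈ unitSq) :
    1 / Real.sqrt ((1 - x 0 ^ 2) * (1 - m * x 0 ^ 2)) * (Real.sqrt (1 - (1 - m) * x 1 ^ 2) / Real.sqrt (1 - x 1 ^ 2)) +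
        Real.sqrt (1 - m * x 0 ^ 2) / Real.sqrt (1 - x 0 ^ 2) * (1 / Real.sqrt ((1 - x 1 ^ 2) * (1 - (1 - m) * x 1 ^ 2))) -
        1 / Real.sqrt ((1 - x 0 ^ 2) * (1 - m * x 0 ^ 2)) * (1 / Real.sqrt ((1 - x 1 ^ 2) * (1 - (1 - m) * x 1 ^ 2))) =
      1 / Real.sqrt (1 - Φ x 0 ^ 2 - Φ x 1 ^ 2) *
        |(1 - m * x 0 ^ 2 - (1 - m) * x 1 ^ 2) / (Real.sqrt (1 - m * x 0 ^ 2) * Real.sqrt (1 - (1 - m) * x 1 ^ 2))| := by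
  have hA : 0 < 1 - x 0 ^ 2 := by linarith [sq_lt_one_zero hx]
  have hB : 0 < 1 - x 1 ^ 2 := by linarith [sq_lt_one_one hx]
  have hC : 0 < 1 - m * x 0 ^ 2 := radC_pos hm hx
  have hD : 0 < 1 - (1 - m) * x 1 ^ 2 := radD_pos hm hx
  have hnum : 0 < 1 - m * x 0 ^ 2 - (1 - m) * x 1 ^ 2 := detNum_pos hm hx
  rw [hΦ0, hΦ1, Real.sqrt_mul hA.le, Real.sqrt_mul hB.le]
  set a := Real.sqrt (1 - x 0 ^ 2) with ha
  set b := Real.sqrt (1 - x 1 ^ 2) with hb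
  set c := Real.sqrt (1 - m * x 0 ^ 2) with hc
  set d := Real.sqrt (1 - (1 - m) * x 1 ^ 2) with hd
  have ha0 : 0 < a := Real.sqrt_pos.2 hA
  have hb0 : 0 < b := Real.sqrt_pos.2 hB
  have hc0 : 0 < c := Real.sqrt_pos.2 hC
  have hd0 : 0 < d := Real.sqrt_pos.2 hD
  have hc2 : c ^ 2 = 1 - m * x 0 ^ 2 := Real.sq_sqrt hC.le
  have hd2 : d ^ 2 = 1 - (1 - m) * x 1 ^ 2 := Real.sq_sqrt hD.le
  have hrad : 1 - (x 0 * d) ^ 2 - (x 1 * c) ^ 2 = (1 - x 0 ^ 2) * (1 - x 1 ^ 2) := by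
    rw [mul_pow, mul_pow, hd2, hc2]; ring
  rw [hrad, Real.sqrt_mul hA.le, ← ha, ← hb]
  rw [abs_of_pos (div_pos hnum (mul_pos hc0 hd0))]
  have ha1 : a ≠ 0 := ha0.ne'
  have hb1 : b ≠ 0 := hb0.ne'
  have hc1 : c ≠ 0 := hc0.ne'
  have hd1 : d ≠ 0 := hd0.ne'
  -- polynomial identity modulo c² and d²
  have key : d ^ 2 + c ^ 2 - 1 = 1 - m * x 0 ^ 2 - (1 - m) * x 1 ^ 2 := by rw [hd2, hc2]; ring
  rw [show 1 / (a * c) * (d / b) + c / a * (1 / (b * d)) - 1 / (a * c) * (1 / (b * d)) =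
      (d ^ 2 + c ^ 2 - 1) / (a * b * c * d) by field_simp]
  rw [show 1 / (a * b) * ((1 - m * x 0 ^ 2 - (1 - m) * x 1 ^ 2) / (c * d)) =
      (1 - m * x 0 ^ 2 - (1 - m) * x 1 ^ 2) / (a * b * c * d) by rw [div_mul_div_comm, one_mul]; ring]
  rw [key]

end sphero_conal

end M2

open M2

/-- **M2a, the sphero-conal chart** (registered stub of line `Sketch`): for `m ∈ (0,1)` the map
`Φ_m(x,y) = (x√(1−(1−m)y²), y√(1−mx²))` is injective on the open square, maps it ONTO the open
quarter disc `Q`, and the one-representation Legendre integrand `F_m` is the pulled-back octant-area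
density `(1 − X² − Z²)^{-1/2}·|det DΦ_m|`. [folklore] -/
theorem stub_spheroConalChart :
    ∀ m : ℝ, m ∈ Ioo (0:ℝ) 1 →
      InjOn (fun x : Fin 2 → ℝ => (![x 0 * Real.sqrt (1 - (1 - m) * x 1 ^ 2), x 1 * Real.sqrt (1 - m * x 0 ^ 2)] : Fin 2 → ℝ)) unitSq ∧
        (fun x : Fin 2 → ℝ => (![x 0 * Real.sqrt (1 - (1 - m) * x 1 ^ 2), x 1 * Real.sqrt (1 - m * x 0 ^ 2)] : Fin 2 → ℝ)) '' unitSq =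
          {w : Fin 2 → ℝ | 0 < w 0 ∧ 0 < w 1 ∧ w 0 ^ 2 + w 1 ^ 2 < 1} ∧
        ∀ x ∈ unitSq,
          1 / Real.sqrt ((1 - x 0 ^ 2) * (1 - m * x 0 ^ 2)) * (Real.sqrt (1 - (1 - m) * x 1 ^ 2) / Real.sqrt (1 - x 1 ^ 2)) +
              Real.sqrt (1 - m * x 0 ^ 2) / Real.sqrt (1 - x 0 ^ 2) * (1 / Real.sqrt ((1 - x 1 ^ 2) * (1 - (1 - m) * x 1 ^ 2))) -
              1 / Real.sqrt ((1 - x 0 ^ 2) * (1 - m * x 0 ^ 2)) * (1 / Real.sqrt ((1 - x 1 ^ 2) * (1 - (1 - m) * x 1 ^ 2))) =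
            1 / Real.sqrt (1 - (x 0 * Real.sqrt (1 - (1 - m) * x 1 ^ 2)) ^ 2 - (x 1 * Real.sqrt (1 - m * x 0 ^ 2)) ^ 2) *
              |(1 - m * x 0 ^ 2 - (1 - m) * x 1 ^ 2) / (Real.sqrt (1 - m * x 0 ^ 2) * Real.sqrt (1 - (1 - m) * x 1 ^ 2))| := by
  intro m hm
  have hΦ0 : ∀ x : Fin 2 → ℝ, (fun x : Fin 2 → ℝ => (![x 0 * Real.sqrt (1 - (1 - m) * x 1 ^ 2), x 1 * Real.sqrt (1 - m * x 0 ^ 2)] : Fin 2 → ℝ)) x 0 =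
      x 0 * Real.sqrt (1 - (1 - m) * x 1 ^ 2) := fun x => by simp
  have hΦ1 : ∀ x : Fin 2 → ℝ, (fun x : Fin 2 → ℝ => (![x 0 * Real.sqrt (1 - (1 - m) * x 1 ^ 2), x 1 * Real.sqrt (1 - m * x 0 ^ 2)] : Fin 2 → ℝ)) x 1 =
      x 1 * Real.sqrt (1 - m * x 0 ^ 2) := fun x => by simp
  refine ⟨spheroConal_injOn hm hΦ0 hΦ1, image_spheroConal hm hΦ0 hΦ1, fun x hx => ?_⟩
  have h := jacobianIdentity hm hΦ0 hΦ1 x hx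
  simpa only [Matrix.cons_val_zero, Matrix.cons_val_one, Matrix.head_cons] using h

end Summit.KontsevichZagierPeriods.UnfoldedStokes.LegendreAllModuliLine
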